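import Literature.MathematicalPhysics.QuantumFieldTheory.Balaban1983to89.B9Thm311SmallFieldClosed
import Literature.MathematicalPhysics.QuantumFieldTheory.Balaban1983to89.B9Ineq369CurvatureOperatorBound
import Literature.MathematicalPhysics.QuantumFieldTheory.Balaban1983to89.B9Eq319CentreLiftL2
import Literature.MathematicalPhysics.QuantumFieldTheory.Balaban1983to89.B9Eq383QSemiLocal
import Literature.MathematicalPhysics.QuantumFieldTheory.Balaban1983to89.B9Eq315QFlatNorm

/-!
# `Balaban1983to89.B9Eq384LaplaceALipschitzUniform` — T. Bałaban, *Propagators for lattice gauge theories in a background field*, Commun. Math. Phys.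
# **99** (1985) 389–434 [Balaban1985BackgroundPropagators] (3.82)–(3.84) p. 407 with Thm 3.4 p. 400: THE pub-balaban NE9 CHAIN'S ASSEMBLED `Δ_a(U)` IS
# LIPSCHITZ IN THE BACKGROUND AT THE FLAT POINT WITH CONSTANTS `K, ε₀, C_Δ, ε₆` CHOSEN BEFORE THE VOLUME — the OWNER's `B9Eq384LaplaceALipschitz`
# with `∃` in front of `∀ m`

statement-level skeleton of published theorems with citation tags; proofs where landed; nothing here is a claim about the Yang–Mills mass gap

PDF held: `paper:balaban1985-cmp99-background-propagators` (+388) pp. 404–407 via the OWNER's `B9Eq384LaplaceALipschitz` ∕ `B9Thm311SmallFieldCoercivity`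
docstrings (verbatim there); p. 406 «a constant O(1) depending on d and L only» (the averaging remainders) first-hand in `B9Eq319CentreLiftL2`.

THE PRINT (verbatim).  p. 407, (3.84): *«Δ_a(U′U) = Δ_a(U) − V(A) = (I − V(A)G(U))Δ_a(U)»*; p. 406: *«a constant O(1) depending on d and L only»*.

WHY THIS FILE (cell context).  The OWNER t4-ne9-p1 g81's (Q1) `B9Eq384LaplaceALipschitz` (p320949) gives the chain's (3.84) at a FIXED lattice: its
`K, ε₀` (§1) and `C_Δ, ε₆` (§2) stand after `∀ m` because of the flat modulus `μ` (fixed after `m`), the operator norm `‖Q(1)‖`, the sup→L² factor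
`C_S = L^d√(c₀·#sites)` and the first averaging letters (`ρ′` in sup currency, `δ_Q ∝ √#Bond(d,m)`).  The OWNER's W-3 (journal l.40982): «(Q1)(Q2)(Q3)(K)
… are OPEN to the ∃-before-∀m programme of ne9-leaf-03 — GO from me».  This file is (Q1)'s twin: his proofs VERBATIM with μ ← `flat_modulus_explicit`,
M_Q ← `norm_QtorusW_one_le`, C_S := 1 (centre-lift currency), ρ ← `norm_centreLift_QprimeW_sub_flat_le_linear`, δ_Q ← `norm_QtorusW_sub_flat_le_local`.

WHAT IS PROVED (sorry-free; 0 `def`; no inequality of the paper asserted as a hypothesis-free fact).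
* §1 **`exists_principalGF_sub_flat_linear_uniform`**: `∃ K ε₀ > 0, ∀ m, ∀ U` (E162 data; `U(b) ∈ U1`, `‖U(b) − 1‖ ≤ ε`, `hRS`, centre-lift
  `Q′`-closeness `ρ`, `‖Q(U)x − Q(1)x‖ ≤ δ_Q‖x‖`, `ε + ρ + δ_Q ≤ ε₀`): `‖P(U)x − P(1)x‖ ≤ K·(ε + ρ + δ_Q)·‖x‖`.
* §2 **`exists_laplaceAofBackground_sub_flat_le_uniform`**: `∃ C_Δ ε₆ > 0, ∀ m, ∀ U` (‖U(b) − 1‖ ≤ ε ≤ ε₆, hRS): `‖Δ_a(U)x − Δ_a(1)x‖ ≤ C_Δ·ε·‖x‖`.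
MODEL / DECLARED READINGS.  (M1)/(M2) as (Q1) (displayed: `hRS`, `M_φ`, `M_φ′`, `C_τ`, `a`, `η ≠ 0`).  (M3) NOT HERE: uniformity in the SPACING, the
gauge step, the resolvent step (3.86) ((Q2)(Q3)), the Banach-norm transfer.
HONEST SCOPE.  The OWNER's mechanism re-run with the leaves' volume-free letters; one quantifier moved in two theorems; constants numbers of `d, L, η, a,
c₀, c₁, M_φ, M_φ′, C_τ`; nothing of [B9] asserted; «NE9 ⇐ the named binders»; NE9 NOT PRINTED ∕ NOT PROVED; NOT summit progress (cell pub-balaban: spine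
PROVED 0/9; rung (B)+1 finite T⁴ — NOT infinite volume, NOT mass gap, NOT Clay; HONEST DEPENDENCY: continuum YM on T⁴ ⇐ BetaPertH ∧ nine spine
estimates (0/9 proved); BetaPertH ⇐ (D1) ∧ (D4) ∧ CAP+tail; G-an2-4 gates asym, D1 and NE2/3/4).  Unit `b2b-balaban-t4-ne9-formalise-leaf-03` (gen 59),
after the OWNER's «GO» W-ne9p1-g81-3; NEW file importing `B9Thm311SmallFieldClosed`, `B9Ineq369CurvatureOperatorBound` (the two imports of
the OWNER's (Q1), which is NOT imported: no declaration of it is used — ne9-leaf-06 g60 W-1), `B9Eq319CentreLiftL2`, `B9Eq383QSemiLocal`,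
`B9Eq315QFlatNorm`; modifies nothing.  Net new unproved facts: 0.
-/

noncomputable section

open scoped InnerProductSpace ComplexConjugate BigOperators

namespace Literature.MathematicalPhysics.QuantumFieldTheory.Balaban1983to89.B9Eq384LaplaceALipschitzUniform

open B4Sect5Torus (TSite)
open B9SectCLatticeCarrier (Bond)
open B7Prop1Explicit (U1 Wcx boxVec)
open B9Eq311L2Pairing (WL2)
open B9Eq319QprimeTorus (fineP centre weight)
open B9Eq319Onto (centreFun)
open B11Eq103H1Complex (SiteL2K BondL2K laplaceALatticeK laplaceAK_apply covLaplaceSiteK)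
open B9Eq310HessianOperator (adTransportW principalOpK hessOp hessOp_apply curvOp)
open B9Eq310DeltaPrime (plaqHolU)
open B9Eq326OperatorAssembly (RofU QprimeW)
open B9Eq315QTorus (perCfg cornerSite QtorusW laplaceAofBackground)
open B9Eq315QTorusOnto (liftSite perSite_liftSite)
open B5Eq172FlatCoercivity (hU1_one hreg_one)
open B9Eq384RemainderLetters (norm_adTransportW_sub_le hRS_one)
open B9Eq323FlatBlockPoincare (flat_modulus_explicit)
open B9Thm311SmallFieldCoercivity (norm_principalGF_sub_flat_le)
open B9Eq319CentreLiftL2 (norm_centreLift_QprimeW_sub_flat_le_linear)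
open B9Eq383QSemiLocal (norm_QtorusW_sub_flat_le_local)
open B9Eq315QFlatNorm (norm_QtorusW_one_le)
open B9Thm311SmallFieldClosed (norm_plaqHolU_sub_one_le)
open B9Ineq369CurvatureOperatorBound (norm_curvOp_le)

/-- arithmetic helper: `B·t ≤ μ/2` when `t ≤ μ/(2B + 1)` (as in `B9Eq384LaplaceALipschitz`). [folklore] -/
private theorem mul_le_half_of_le_div {B μ t : ℝ} (hB : 0 ≤ B) (hμ : 0 ≤ μ) (ht : t ≤ μ / (2 * B + 1)) : B * t ≤ μ / 2 := by
  have h1 : B * t ≤ B * (μ / (2 * B + 1)) := mul_le_mul_of_nonneg_left ht hB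
  have h2 : B * (μ / (2 * B + 1)) ≤ μ / 2 := by
    rw [mul_div_assoc', div_le_div_iff₀ (by positivity) (by norm_num)]; nlinarith
  exact h1.trans h2

variable {d : ℕ} (L : ℕ) [NeZero L] (hL : 1 ≤ L)
  {𝔸 : Type*} [NormedRing 𝔸] [NormedAlgebra ℂ 𝔸] [CompleteSpace 𝔸] [NormOneClass 𝔸]
  {W : Type*} [NormedAddCommGroup W] [InnerProductSpace ℂ W] [FiniteDimensional ℂ W] (φ : W ≃ₗ[ℂ] 𝔸) {c₀ c₁ : ℝ} [Fact (0 < c₀)] [Fact (0 < c₁)]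

/-! ## §1 (3.82) linear form, `K, ε₀` before the volume -/
set_option maxHeartbeats 400000 in
/-- **(3.82)∕(3.84) FOR THE CHAIN'S PRINCIPAL GAUGE-FIXED OPERATOR, LINEAR IN THE SMALLNESS LETTERS, WITH `K, ε₀` CHOSEN BEFORE THE VOLUME** —
the OWNER's `B9Eq384LaplaceALipschitz.exists_principalGF_sub_flat_linear` with `∃ K ε₀` in front of `∀ m`: his proof VERBATIM on his §5
`B9Thm311SmallFieldCoercivity.norm_principalGF_sub_flat_le`, with the three volume-dependent inputs replaced by volume-free tree letters — the flat
modulus `μ := 2∕(L²η²)` (ne9-leaf-04's `B9Eq323FlatBlockPoincare.flat_modulus_explicit`), the bound `M_Q := M_φ′M_φ√(c₁∕(c₀L^d))` of `Q(1)`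
(ne9-leaf-03's `B9Eq315QFlatNorm.norm_QtorusW_one_le`), and `C_S := 1` (the `Q′`-closeness hypothesis in the centre-lift currency of §5's own
`hρ` slot): `‖P(U)x − P(1)x‖ ≤ K·(ε + ρ + δ_Q)·‖x‖` for every volume `m`. [cite: Balaban1985BackgroundPropagators, (3.82)–(3.84) p.407, (3.70)–(3.77) pp.404–406] -/
theorem exists_principalGF_sub_flat_linear_uniform {η : ℝ} (hη : η ≠ 0) (a : ℝ) {Mφ Mφ' : ℝ} (hMφ : 0 ≤ Mφ) (hMφ' : 0 ≤ Mφ')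
    (hφ : ∀ w, ‖φ w‖ ≤ Mφ * ‖w‖) (hφ' : ∀ X, ‖φ.symm X‖ ≤ Mφ' * ‖X‖) :
    ∃ K ε₀ : ℝ, 0 < K ∧ 0 < ε₀ ∧ ∀ (m : Fin d → ℕ) [∀ i, NeZero (fineP L m i)]
      (U : Bond d (fineP L m) → 𝔸ˣ) {α : ℝ} (hα1 : α ≤ 1 / 64)
      (hU1 : ∀ (x : B7Prop1Explicit.Site d) (κ : Fin d), perCfg (fineP L m) U x κ ∈ U1 𝔸)
      (hreg : ∀ (y : TSite d m) (κ : Fin d) (r : Fin d → Fin L), ‖((Wcx L (perCfg (fineP L m) U) (cornerSite L y) κ (boxVec L r) : 𝔸ˣ) : 𝔸) - 1‖ ≤ α)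
      {ε ρ' δQ : ℝ}, 0 ≤ ε → 0 ≤ ρ' → 0 ≤ δQ → ε + ρ' + δQ ≤ ε₀ →
      (∀ b, U b ∈ U1 𝔸) → (∀ b, ‖(U b : 𝔸) - 1‖ ≤ ε) →
      (∀ (b : Bond d (fineP L m)) (v u : W), ⟪adTransportW φ U b v, u⟫_ℂ = ⟪v, adTransportW φ (fun b => (U b)⁻¹) b u⟫_ℂ) →
      (∀ l : SiteL2K ℂ d (fineP L m) c₀ W,
        ‖(WL2.equiv ℂ (fun _ : TSite d (fineP L m) => c₀) W).symm (centreFun (weight L m) (centre L m)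
          (QprimeW L m φ U l - QprimeW L m φ (fun _ : Bond d (fineP L m) => (1 : 𝔸ˣ)) l))‖ ≤ ρ' * ‖l‖) →
      (∀ x : BondL2K ℂ d (fineP L m) c₀ W, ‖QtorusW L m hL φ U hα1 hU1 hreg (c₁ := c₁) x -
        QtorusW L m hL φ (fun _ => 1) (show (0 : ℝ) ≤ 1 / 64 by norm_num) (hU1_one L m) (hreg_one L m) (c₁ := c₁) x‖ ≤ δQ * ‖x‖) →
      ∀ x : BondL2K ℂ d (fineP L m) c₀ W,
        ‖laplaceALatticeK ((η : ℂ))⁻¹ (adTransportW φ U) (adTransportW φ fun b => (U b)⁻¹) (principalOpK φ η U) (RofU L m φ η U)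
            (QtorusW L m hL φ U hα1 hU1 hreg (c₁ := c₁)) a x -
          laplaceALatticeK ((η : ℂ))⁻¹ (adTransportW φ (fun _ : Bond d (fineP L m) => (1 : 𝔸ˣ)))
            (adTransportW φ fun _ : Bond d (fineP L m) => (1 : 𝔸ˣ)⁻¹) (principalOpK φ η fun _ => 1) (RofU L m φ η fun _ => 1)
            (QtorusW L m hL φ (fun _ => 1) (show (0 : ℝ) ≤ 1 / 64 by norm_num) (hU1_one L m) (hreg_one L m) (c₁ := c₁)) a x‖ ≤
        K * (ε + ρ' + δQ) * ‖x‖ := by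
  have hc₀ : 0 < c₀ := Fact.out
  -- the flat constants, VOLUME-FREE: `μ = 2/(L²η²)` (ne9-leaf-04), `MQ = M_φ′M_φ√(c₁/(c₀L^d))` (ne9-leaf-03)
  have hc₁ : 0 < c₁ := Fact.out
  have hL0 : (0 : ℝ) < L := by exact_mod_cast Nat.pos_of_ne_zero (NeZero.ne L)
  obtain ⟨μ, hμdef⟩ : ∃ μ : ℝ, μ = 2 / ((L : ℝ) ^ 2 * η ^ 2) := ⟨_, rfl⟩
  have hμ : 0 < μ := by rw [hμdef]; positivity
  obtain ⟨MQ, hMQdef⟩ : ∃ MQ : ℝ, MQ = Mφ' * Mφ * Real.sqrt (c₁ / (c₀ * (L : ℝ) ^ d)) := ⟨_, rfl⟩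
  have hMQ : 0 ≤ MQ := by rw [hMQdef]; positivity
  -- the lattice constants
  have hnc : 0 ≤ ‖((η : ℂ))⁻¹‖ := norm_nonneg _
  obtain ⟨KR, hKRdef⟩ : ∃ KR : ℝ, KR = 2 * Mφ * Mφ' := ⟨_, rfl⟩
  have hKR : 0 ≤ KR := by rw [hKRdef]; positivity
  obtain ⟨CS, hCSdef⟩ : ∃ CS : ℝ, CS = 1 := ⟨_, rfl⟩
  have hCS : 0 ≤ CS := by rw [hCSdef]; positivity
  obtain ⟨B, hBdef⟩ : ∃ B : ℝ, B = μ * CS + 6 * ‖((η : ℂ))⁻¹‖ ^ 2 * d * KR + 16 * ‖((η : ℂ))⁻¹‖ ^ 2 * d * CS := ⟨_, rfl⟩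
  have hB : 0 ≤ B := by rw [hBdef]; positivity
  obtain ⟨K, hKdef⟩ : ∃ K : ℝ, K = 48 * d * ‖((η : ℂ))⁻¹‖ ^ 2 * KR + 8 * ‖((η : ℂ))⁻¹‖ ^ 2 * d * KR + 64 * ‖((η : ℂ))⁻¹‖ ^ 2 * d * (6 * ‖((η : ℂ))⁻¹‖ ^ 2 * d * KR + 16 * ‖((η : ℂ))⁻¹‖ ^ 2 * d * CS) / μ
    + |a| * (2 * MQ + 1) + 1 := ⟨_, rfl⟩
  have hK : 0 < K := by rw [hKdef]; positivity
  refine ⟨K, min (1 / (KR + 1)) (μ / (2 * B + 1)), hK, by positivity, ?_⟩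
  intro m _ U α hα1 hU1 hreg ε ρ' δQ hε hρ' hδQ ht hUb hUε hRS hQ' hQ x
  -- the per-lattice letters at these constants
  have hmod : ∀ l : SiteL2K ℂ d (fineP L m) c₀ W, QprimeW L m φ (fun _ : Bond d (fineP L m) => (1 : 𝔸ˣ)) l = 0 →
      μ * ‖l‖ ≤ ‖covLaplaceSiteK ((η : ℂ))⁻¹ (adTransportW φ (fun _ : Bond d (fineP L m) => (1 : 𝔸ˣ)))
        (adTransportW φ fun _ : Bond d (fineP L m) => (1 : 𝔸ˣ)⁻¹) l‖ := fun l hl => by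
    rw [hμdef]; exact flat_modulus_explicit L m φ hη l hl
  have hQ₁ : ∀ x : BondL2K ℂ d (fineP L m) c₀ W,
      ‖QtorusW L m hL φ (fun _ => 1) (show (0 : ℝ) ≤ 1 / 64 by norm_num) (hU1_one L m) (hreg_one L m) (c₀ := c₀) (c₁ := c₁) x‖ ≤ MQ * ‖x‖ :=
    fun x => by
      rw [hMQdef]
      exact norm_QtorusW_one_le L m hL (show (0 : ℝ) ≤ 1 / 64 by norm_num) (hU1_one L m) (hreg_one L m) φ hMφ hφ hMφ' hφ' x
  -- `t = ε + ρ′ + δ_Q` and its consequences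
  have ht1 : ε + ρ' + δQ ≤ 1 / (KR + 1) := ht.trans (min_le_left _ _)
  have ht2 : ε + ρ' + δQ ≤ μ / (2 * B + 1) := ht.trans (min_le_right _ _)
  have hεt : ε ≤ ε + ρ' + δQ := by linarith
  have hρt : ρ' ≤ ε + ρ' + δQ := by linarith
  have hδQt : δQ ≤ ε + ρ' + δQ := by linarith
  have ht01 : ε + ρ' + δQ ≤ 1 := ht1.trans (by rw [div_le_one (by positivity)]; linarith)
  have hδQ1 : δQ ≤ 1 := hδQt.trans ht01
  have ht0 : 0 ≤ ε + ρ' + δQ := by positivity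
  -- the letters of `norm_principalGF_sub_flat_le`
  obtain ⟨εR, hεRdef⟩ : ∃ εR : ℝ, εR = KR * ε := ⟨_, rfl⟩
  have hεR : 0 ≤ εR := by rw [hεRdef]; positivity
  have hεRt : εR ≤ KR * (ε + ρ' + δQ) := by rw [hεRdef]; exact mul_le_mul_of_nonneg_left hεt hKR
  have hεR1 : εR ≤ 1 := by
    refine hεRt.trans ((mul_le_mul_of_nonneg_left ht1 hKR).trans ?_)
    rw [mul_one_div, div_le_one (by positivity)]; linarith
  have hR : ∀ (b : Bond d (fineP L m)) (w : W), ‖adTransportW φ U b w - w‖ ≤ εR * ‖w‖ := fun b w => by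
    have h := norm_adTransportW_sub_le φ hφ hφ' hMφ' U b (hUb b) (hUε b) w
    rw [hεRdef, hKRdef]; linarith
  obtain ⟨ρ, hρdef⟩ : ∃ ρ : ℝ, ρ = CS * ρ' := ⟨_, rfl⟩
  have hρ0 : 0 ≤ ρ := by rw [hρdef]; positivity
  have hρ : ∀ l : SiteL2K ℂ d (fineP L m) c₀ W,
      ‖(WL2.equiv ℂ (fun _ : TSite d (fineP L m) => c₀) W).symm (centreFun (weight L m) (centre L m)
        (QprimeW L m φ U l - QprimeW L m φ (fun _ : Bond d (fineP L m) => (1 : 𝔸ˣ)) l))‖ ≤ ρ * ‖l‖ := fun l => by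
    rw [hρdef, hCSdef, one_mul]; exact hQ' l
  have hρt : ρ ≤ CS * (ε + ρ' + δQ) := by rw [hρdef]; exact mul_le_mul_of_nonneg_left hρt hCS
  -- smallness bookkeeping: `εΔ + Mρ + μρ ≤ B·t ≤ μ/2`
  have hd0 : (0 : ℝ) ≤ d := Nat.cast_nonneg d
  have hsd : Real.sqrt d * Real.sqrt d = d := Real.mul_self_sqrt hd0
  have hεΔ : 2 * (2 + εR) * ‖((η : ℂ))⁻¹‖ ^ 2 * d * εR ≤ 6 * ‖((η : ℂ))⁻¹‖ ^ 2 * d * KR * (ε + ρ' + δQ) := by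
    have h1 : 2 * (2 + εR) ≤ 6 := by linarith
    calc 2 * (2 + εR) * ‖((η : ℂ))⁻¹‖ ^ 2 * d * εR = (2 * (2 + εR)) * (‖((η : ℂ))⁻¹‖ ^ 2 * d * εR) := by ring
      _ ≤ 6 * (‖((η : ℂ))⁻¹‖ ^ 2 * d * (KR * (ε + ρ' + δQ))) :=
          mul_le_mul h1 (mul_le_mul_of_nonneg_left hεRt (by positivity)) (by positivity) (by norm_num)
      _ = 6 * ‖((η : ℂ))⁻¹‖ ^ 2 * d * KR * (ε + ρ' + δQ) := by ring
  have hM16 : 4 * (1 + εR) ^ 2 * ‖((η : ℂ))⁻¹‖ ^ 2 * d ≤ 16 * ‖((η : ℂ))⁻¹‖ ^ 2 * d := by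
    have h1 : (1 + εR) ^ 2 ≤ 4 := by
      calc (1 + εR) ^ 2 ≤ 2 ^ 2 := pow_le_pow_left₀ (by positivity) (by linarith) 2
        _ = 4 := by norm_num
    calc 4 * (1 + εR) ^ 2 * ‖((η : ℂ))⁻¹‖ ^ 2 * d = (1 + εR) ^ 2 * (4 * ‖((η : ℂ))⁻¹‖ ^ 2 * d) := by ring
      _ ≤ 4 * (4 * ‖((η : ℂ))⁻¹‖ ^ 2 * d) := mul_le_mul_of_nonneg_right h1 (by positivity)
      _ = 16 * ‖((η : ℂ))⁻¹‖ ^ 2 * d := by ring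
  have hMρ : 4 * (1 + εR) ^ 2 * ‖((η : ℂ))⁻¹‖ ^ 2 * d * ρ ≤ 16 * ‖((η : ℂ))⁻¹‖ ^ 2 * d * CS * (ε + ρ' + δQ) :=
    calc 4 * (1 + εR) ^ 2 * ‖((η : ℂ))⁻¹‖ ^ 2 * d * ρ ≤ 16 * ‖((η : ℂ))⁻¹‖ ^ 2 * d * ρ := mul_le_mul_of_nonneg_right hM16 hρ0
      _ ≤ 16 * ‖((η : ℂ))⁻¹‖ ^ 2 * d * (CS * (ε + ρ' + δQ)) := mul_le_mul_of_nonneg_left hρt (by positivity)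
      _ = 16 * ‖((η : ℂ))⁻¹‖ ^ 2 * d * CS * (ε + ρ' + δQ) := by ring
  have hμρ : μ * ρ ≤ μ * CS * (ε + ρ' + δQ) := by
    rw [mul_assoc]; exact mul_le_mul_of_nonneg_left hρt hμ.le
  have hBt : B * (ε + ρ' + δQ) ≤ μ / 2 := mul_le_half_of_le_div hB hμ.le ht2
  have hsum : μ * ρ + (2 * (2 + εR) * ‖((η : ℂ))⁻¹‖ ^ 2 * d * εR + 4 * (1 + εR) ^ 2 * ‖((η : ℂ))⁻¹‖ ^ 2 * d * ρ) ≤ μ / 2 := by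
    have : μ * CS * (ε + ρ' + δQ) + (6 * ‖((η : ℂ))⁻¹‖ ^ 2 * d * KR * (ε + ρ' + δQ) + 16 * ‖((η : ℂ))⁻¹‖ ^ 2 * d * CS * (ε + ρ' + δQ)) = B * (ε + ρ' + δQ) := by
      rw [hBdef]; ring
    linarith [hμρ, hεΔ, hMρ]
  have hrew : μ * (1 - ρ) - (2 * (2 + εR) * ‖((η : ℂ))⁻¹‖ ^ 2 * d * εR + 4 * (1 + εR) ^ 2 * ‖((η : ℂ))⁻¹‖ ^ 2 * d * ρ) =
      μ - (μ * ρ + (2 * (2 + εR) * ‖((η : ℂ))⁻¹‖ ^ 2 * d * εR + 4 * (1 + εR) ^ 2 * ‖((η : ℂ))⁻¹‖ ^ 2 * d * ρ)) := by ring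
  have hν2 : μ / 2 ≤ μ * (1 - ρ) - (2 * (2 + εR) * ‖((η : ℂ))⁻¹‖ ^ 2 * d * εR + 4 * (1 + εR) ^ 2 * ‖((η : ℂ))⁻¹‖ ^ 2 * d * ρ) := by
    rw [hrew]; linarith
  have hν : 0 < μ * (1 - ρ) - (2 * (2 + εR) * ‖((η : ℂ))⁻¹‖ ^ 2 * d * εR + 4 * (1 + εR) ^ 2 * ‖((η : ℂ))⁻¹‖ ^ 2 * d * ρ) :=
    lt_of_lt_of_le (by positivity) hν2
  -- the `R`-remainder
  have hδR : 2 * (2 * (2 + εR) * ‖((η : ℂ))⁻¹‖ ^ 2 * d * εR + 4 * (1 + εR) ^ 2 * ‖((η : ℂ))⁻¹‖ ^ 2 * d * ρ) /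
      (μ * (1 - ρ) - (2 * (2 + εR) * ‖((η : ℂ))⁻¹‖ ^ 2 * d * εR + 4 * (1 + εR) ^ 2 * ‖((η : ℂ))⁻¹‖ ^ 2 * d * ρ)) ≤
      4 * (6 * ‖((η : ℂ))⁻¹‖ ^ 2 * d * KR + 16 * ‖((η : ℂ))⁻¹‖ ^ 2 * d * CS) * (ε + ρ' + δQ) / μ := by
    have hnum : 0 ≤ 2 * (2 * (2 + εR) * ‖((η : ℂ))⁻¹‖ ^ 2 * d * εR + 4 * (1 + εR) ^ 2 * ‖((η : ℂ))⁻¹‖ ^ 2 * d * ρ) := by positivity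
    calc _ ≤ 2 * (2 * (2 + εR) * ‖((η : ℂ))⁻¹‖ ^ 2 * d * εR + 4 * (1 + εR) ^ 2 * ‖((η : ℂ))⁻¹‖ ^ 2 * d * ρ) / (μ / 2) :=
          div_le_div_of_nonneg_left hnum (by positivity) hν2
      _ = 4 * (2 * (2 + εR) * ‖((η : ℂ))⁻¹‖ ^ 2 * d * εR + 4 * (1 + εR) ^ 2 * ‖((η : ℂ))⁻¹‖ ^ 2 * d * ρ) / μ := by
          field_simp; ring
      _ ≤ 4 * (6 * ‖((η : ℂ))⁻¹‖ ^ 2 * d * KR * (ε + ρ' + δQ) + 16 * ‖((η : ℂ))⁻¹‖ ^ 2 * d * CS * (ε + ρ' + δQ)) / μ := by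
          gcongr
      _ = 4 * (6 * ‖((η : ℂ))⁻¹‖ ^ 2 * d * KR + 16 * ‖((η : ℂ))⁻¹‖ ^ 2 * d * CS) * (ε + ρ' + δQ) / μ := by ring
  -- the four pieces against `K·t`
  have hP' : 16 * d * (2 + εR) * ‖((η : ℂ))⁻¹‖ ^ 2 * εR ≤ 48 * d * ‖((η : ℂ))⁻¹‖ ^ 2 * KR * (ε + ρ' + δQ) := by
    have h1 : 2 + εR ≤ 3 := by linarith
    calc 16 * d * (2 + εR) * ‖((η : ℂ))⁻¹‖ ^ 2 * εR = (16 * d * ‖((η : ℂ))⁻¹‖ ^ 2) * ((2 + εR) * εR) := by ring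
      _ ≤ (16 * d * ‖((η : ℂ))⁻¹‖ ^ 2) * (3 * (KR * (ε + ρ' + δQ))) :=
          mul_le_mul_of_nonneg_left (mul_le_mul h1 hεRt hεR (by norm_num)) (by positivity)
      _ = 48 * d * ‖((η : ℂ))⁻¹‖ ^ 2 * KR * (ε + ρ' + δQ) := by ring
  have hD' : 2 * (2 * (1 + εR) * ‖((η : ℂ))⁻¹‖ * Real.sqrt d) * (‖((η : ℂ))⁻¹‖ * εR * Real.sqrt d) ≤ 8 * ‖((η : ℂ))⁻¹‖ ^ 2 * d * KR * (ε + ρ' + δQ) := by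
    have h1 : 1 + εR ≤ 2 := by linarith
    calc 2 * (2 * (1 + εR) * ‖((η : ℂ))⁻¹‖ * Real.sqrt d) * (‖((η : ℂ))⁻¹‖ * εR * Real.sqrt d) = 4 * ‖((η : ℂ))⁻¹‖ ^ 2 * (Real.sqrt d * Real.sqrt d) * ((1 + εR) * εR) := by ring
      _ = 4 * ‖((η : ℂ))⁻¹‖ ^ 2 * d * ((1 + εR) * εR) := by rw [hsd]
      _ ≤ 4 * ‖((η : ℂ))⁻¹‖ ^ 2 * d * (2 * (KR * (ε + ρ' + δQ))) :=
          mul_le_mul_of_nonneg_left (mul_le_mul h1 hεRt hεR (by norm_num)) (by positivity)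
      _ = 8 * ‖((η : ℂ))⁻¹‖ ^ 2 * d * KR * (ε + ρ' + δQ) := by ring
  have hR' : (2 * (1 + εR) * ‖((η : ℂ))⁻¹‖ * Real.sqrt d) ^ 2 *
      (2 * (2 * (2 + εR) * ‖((η : ℂ))⁻¹‖ ^ 2 * d * εR + 4 * (1 + εR) ^ 2 * ‖((η : ℂ))⁻¹‖ ^ 2 * d * ρ) /
        (μ * (1 - ρ) - (2 * (2 + εR) * ‖((η : ℂ))⁻¹‖ ^ 2 * d * εR + 4 * (1 + εR) ^ 2 * ‖((η : ℂ))⁻¹‖ ^ 2 * d * ρ))) ≤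
      64 * ‖((η : ℂ))⁻¹‖ ^ 2 * d * (6 * ‖((η : ℂ))⁻¹‖ ^ 2 * d * KR + 16 * ‖((η : ℂ))⁻¹‖ ^ 2 * d * CS) / μ * (ε + ρ' + δQ) := by
    have hsq : (2 * (1 + εR) * ‖((η : ℂ))⁻¹‖ * Real.sqrt d) ^ 2 = 4 * (1 + εR) ^ 2 * ‖((η : ℂ))⁻¹‖ ^ 2 * d := by
      rw [show (2 * (1 + εR) * ‖((η : ℂ))⁻¹‖ * Real.sqrt d) ^ 2 = 4 * (1 + εR) ^ 2 * ‖((η : ℂ))⁻¹‖ ^ 2 * (Real.sqrt d * Real.sqrt d) by ring, hsd]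
    rw [hsq]
    have hδR0 : 0 ≤ 2 * (2 * (2 + εR) * ‖((η : ℂ))⁻¹‖ ^ 2 * d * εR + 4 * (1 + εR) ^ 2 * ‖((η : ℂ))⁻¹‖ ^ 2 * d * ρ) /
        (μ * (1 - ρ) - (2 * (2 + εR) * ‖((η : ℂ))⁻¹‖ ^ 2 * d * εR + 4 * (1 + εR) ^ 2 * ‖((η : ℂ))⁻¹‖ ^ 2 * d * ρ)) := div_nonneg (by positivity) hν.le
    calc 4 * (1 + εR) ^ 2 * ‖((η : ℂ))⁻¹‖ ^ 2 * d * (2 * (2 * (2 + εR) * ‖((η : ℂ))⁻¹‖ ^ 2 * d * εR + 4 * (1 + εR) ^ 2 * ‖((η : ℂ))⁻¹‖ ^ 2 * d * ρ) /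
          (μ * (1 - ρ) - (2 * (2 + εR) * ‖((η : ℂ))⁻¹‖ ^ 2 * d * εR + 4 * (1 + εR) ^ 2 * ‖((η : ℂ))⁻¹‖ ^ 2 * d * ρ)))
        ≤ 16 * ‖((η : ℂ))⁻¹‖ ^ 2 * d * (4 * (6 * ‖((η : ℂ))⁻¹‖ ^ 2 * d * KR + 16 * ‖((η : ℂ))⁻¹‖ ^ 2 * d * CS) * (ε + ρ' + δQ) / μ) :=
          mul_le_mul hM16 hδR hδR0 (by positivity)
      _ = 64 * ‖((η : ℂ))⁻¹‖ ^ 2 * d * (6 * ‖((η : ℂ))⁻¹‖ ^ 2 * d * KR + 16 * ‖((η : ℂ))⁻¹‖ ^ 2 * d * CS) / μ * (ε + ρ' + δQ) := by ring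
  have hQ'' : |a| * δQ * (2 * MQ + δQ) ≤ |a| * (2 * MQ + 1) * (ε + ρ' + δQ) := by
    have h1 : 2 * MQ + δQ ≤ 2 * MQ + 1 := by linarith
    calc |a| * δQ * (2 * MQ + δQ) = |a| * (δQ * (2 * MQ + δQ)) := by ring
      _ ≤ |a| * ((ε + ρ' + δQ) * (2 * MQ + 1)) :=
          mul_le_mul_of_nonneg_left (mul_le_mul hδQt h1 (by positivity) (by positivity)) (abs_nonneg a)
      _ = |a| * (2 * MQ + 1) * (ε + ρ' + δQ) := by ring
  have hδ : 16 * d * (2 + εR) * ‖((η : ℂ))⁻¹‖ ^ 2 * εR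
      + 2 * (2 * (1 + εR) * ‖((η : ℂ))⁻¹‖ * Real.sqrt d) * (‖((η : ℂ))⁻¹‖ * εR * Real.sqrt d)
      + (2 * (1 + εR) * ‖((η : ℂ))⁻¹‖ * Real.sqrt d) ^ 2 *
        (2 * (2 * (2 + εR) * ‖((η : ℂ))⁻¹‖ ^ 2 * d * εR + 4 * (1 + εR) ^ 2 * ‖((η : ℂ))⁻¹‖ ^ 2 * d * ρ) /
          (μ * (1 - ρ) - (2 * (2 + εR) * ‖((η : ℂ))⁻¹‖ ^ 2 * d * εR + 4 * (1 + εR) ^ 2 * ‖((η : ℂ))⁻¹‖ ^ 2 * d * ρ)))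
      + |a| * δQ * (2 * MQ + δQ) ≤ K * (ε + ρ' + δQ) := by
    have hKsum : 48 * d * ‖((η : ℂ))⁻¹‖ ^ 2 * KR * (ε + ρ' + δQ) + 8 * ‖((η : ℂ))⁻¹‖ ^ 2 * d * KR * (ε + ρ' + δQ)
        + 64 * ‖((η : ℂ))⁻¹‖ ^ 2 * d * (6 * ‖((η : ℂ))⁻¹‖ ^ 2 * d * KR + 16 * ‖((η : ℂ))⁻¹‖ ^ 2 * d * CS) / μ * (ε + ρ' + δQ) + |a| * (2 * MQ + 1) * (ε + ρ' + δQ)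
        + 1 * (ε + ρ' + δQ) = K * (ε + ρ' + δQ) := by rw [hKdef]; ring
    have h1t : 0 ≤ 1 * (ε + ρ' + δQ) := by positivity
    calc _ ≤ 48 * d * ‖((η : ℂ))⁻¹‖ ^ 2 * KR * (ε + ρ' + δQ) + 8 * ‖((η : ℂ))⁻¹‖ ^ 2 * d * KR * (ε + ρ' + δQ)
        + 64 * ‖((η : ℂ))⁻¹‖ ^ 2 * d * (6 * ‖((η : ℂ))⁻¹‖ ^ 2 * d * KR + 16 * ‖((η : ℂ))⁻¹‖ ^ 2 * d * CS) / μ * (ε + ρ' + δQ)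
        + |a| * (2 * MQ + 1) * (ε + ρ' + δQ) := add_le_add (add_le_add (add_le_add hP' hD') hR') hQ''
      _ ≤ _ + 1 * (ε + ρ' + δQ) := le_add_of_nonneg_right h1t
      _ = K * (ε + ρ' + δQ) := hKsum
  exact (norm_principalGF_sub_flat_le L m hL φ η a U hα1 hU1 hreg hεR hρ0 hδQ hMQ hμ hR hRS hmod hρ hQ hQ₁ hν x).trans
    (mul_le_mul_of_nonneg_right hδ (norm_nonneg _))

/-! ## §2 (3.84) for the assembled `Δ_a(U)`, `C_Δ, ε₆` before the volume -/

section Assembled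

variable [StarRing 𝔸] [NormedStarGroup 𝔸] [StarModule ℂ 𝔸]

/-- **(3.84) «Δ_a(U′U) = Δ_a(U) − V(A)», `‖V‖ = O(ε)`, WITH `C_Δ, ε₆` CHOSEN BEFORE THE VOLUME** — the OWNER's `exists_laplaceAofBackground_sub_
flat_le` with `∃ C_Δ ε₆` in front of `∀ m`: §1 + the volume-free averaging letters (ρ ← ne9-leaf-03's `B9Eq319CentreLiftL2.norm_centreLift_QprimeW_
sub_flat_le_linear`, δ_Q ← ne9-leaf-04's `B9Eq383QSemiLocal.norm_QtorusW_sub_flat_le_local`) + the curvature part (`B9Ineq369CurvatureOperatorBound.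
norm_curvOp_le`, m-free).  `‖Δ_a(U)x − Δ_a(1)x‖ ≤ C_Δ·ε·‖x‖` for every volume `m` and every small field.
[cite: Balaban1985BackgroundPropagators, (3.82)–(3.84) p.407, (3.69) p.404, (3.26) p.395] -/
theorem exists_laplaceAofBackground_sub_flat_le_uniform {η : ℝ} (hη : η ≠ 0) (a : ℝ) {Mφ Mφ' : ℝ} (hMφ : 0 ≤ Mφ) (hMφ' : 0 ≤ Mφ')
    (hφ : ∀ w, ‖φ w‖ ≤ Mφ * ‖w‖) (hφ' : ∀ X, ‖φ.symm X‖ ≤ Mφ' * ‖X‖) (τ : 𝔸 →ₗ[ℂ] ℂ) {Cτ : ℝ} (hτ : ∀ X, ‖τ X‖ ≤ Cτ * ‖X‖) (hCτ : 0 ≤ Cτ) :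
    ∃ CΔ ε₆ : ℝ, 0 < CΔ ∧ 0 < ε₆ ∧ ∀ (m : Fin d → ℕ) [∀ i, NeZero (fineP L m i)]
      (U : Bond d (fineP L m) → 𝔸ˣ) {α : ℝ} (hα1 : α ≤ 1 / 64)
      (hU1 : ∀ (x : B7Prop1Explicit.Site d) (κ : Fin d), perCfg (fineP L m) U x κ ∈ U1 𝔸)
      (hreg : ∀ (y : TSite d m) (κ : Fin d) (r : Fin d → Fin L), ‖((Wcx L (perCfg (fineP L m) U) (cornerSite L y) κ (boxVec L r) : 𝔸ˣ) : 𝔸) - 1‖ ≤ α)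
      {ε : ℝ}, 0 ≤ ε → ε ≤ ε₆ → (∀ b, ‖(U b : 𝔸) - 1‖ ≤ ε) →
      (∀ (b : Bond d (fineP L m)) (v u : W), ⟪adTransportW φ U b v, u⟫_ℂ = ⟪v, adTransportW φ (fun b => (U b)⁻¹) b u⟫_ℂ) →
      ∀ x : BondL2K ℂ d (fineP L m) c₀ W,
        ‖laplaceAofBackground L m hL φ U hα1 hU1 hreg τ η (c₀ := c₀) (c₁ := c₁) a x -
          laplaceAofBackground L m hL φ (fun _ => 1) (show (0 : ℝ) ≤ 1 / 64 by norm_num) (hU1_one L m) (hreg_one L m) τ η (c₀ := c₀) (c₁ := c₁) a x‖ ≤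
        CΔ * ε * ‖x‖ := by
  have hc₀ : 0 < c₀ := Fact.out
  obtain ⟨K, ε₀, hK, hε₀, HP⟩ := exists_principalGF_sub_flat_linear_uniform L hL φ (c₀ := c₀) (c₁ := c₁) hη a hMφ hMφ' hφ hφ'
  -- the three linear rates (as in `B9Thm311SmallFieldClosed`): `εR = KR·ε`, `ρ′ ≤ Cρ·εR`, `δ_Q = CQ·ε`; the curvature rate `Kc`
  obtain ⟨KR, hKRdef⟩ : ∃ KR : ℝ, KR = 2 * Mφ * Mφ' := ⟨_, rfl⟩
  have hKR : 0 ≤ KR := by rw [hKRdef]; positivity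
  obtain ⟨Cρ, hCρdef⟩ : ∃ Cρ : ℝ, Cρ = Real.sqrt ((L : ℝ) ^ d) * ((d * (L - 1) : ℕ) * 2 ^ (d * (L - 1))) := ⟨_, rfl⟩
  have hCρ : 0 ≤ Cρ := by rw [hCρdef]; positivity
  obtain ⟨CQ, hCQdef⟩ : ∃ CQ : ℝ, CQ = Mφ' * Mφ * Real.sqrt (2 * d * c₁ / c₀) * (102 * (d + 1) ^ 2 * L) := ⟨_, rfl⟩
  have hCQ : 0 ≤ CQ := by rw [hCQdef]; positivity
  obtain ⟨Kc, hKcdef⟩ : ∃ Kc : ℝ, Kc = 32 * d * Cτ * Mφ ^ 2 * (|η| ^ d / c₀) * (‖((η : ℂ))⁻¹‖ ^ 2 * 4) := ⟨_, rfl⟩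
  have hKc : 0 ≤ Kc := by rw [hKcdef]; positivity
  refine ⟨K * (1 + Cρ * KR + CQ) + Kc + 1, min (1 / (KR + 1)) (ε₀ / (1 + Cρ * KR + CQ)), by positivity, by positivity, ?_⟩
  intro m _ U α hα1 hU1 hreg ε hε hε₆ hUε hRS x
  have ht1 : ε ≤ 1 / (KR + 1) := hε₆.trans (min_le_left _ _)
  have ht2 : ε ≤ ε₀ / (1 + Cρ * KR + CQ) := hε₆.trans (min_le_right _ _)
  have hUb : ∀ b : Bond d (fineP L m), U b ∈ U1 𝔸 := fun b => by
    obtain ⟨y, κ⟩ := b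
    have h := hU1 (liftSite y) κ
    rwa [B9Eq315QTorus.perCfg_apply, perSite_liftSite] at h
  have hUb' : ∀ b : Bond d (fineP L m), ‖(U b : 𝔸)‖ ≤ 1 ∧ ‖(((U b)⁻¹ : 𝔸ˣ) : 𝔸)‖ ≤ 1 := fun b => B7Prop1Explicit.mem_U1.1 (hUb b)
  have hR : ∀ (b : Bond d (fineP L m)) (w : W), ‖adTransportW φ U b w - w‖ ≤ KR * ε * ‖w‖ := fun b w => by
    have h := norm_adTransportW_sub_le φ hφ hφ' hMφ' U b (hUb b) (hUε b) w
    rw [hKRdef]; linarith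
  have hεR0 : 0 ≤ KR * ε := by positivity
  -- (ρ) in the centre-lift currency, by ne9-leaf-03's `B9Eq319CentreLiftL2` (volume-free)
  have hεR1 : KR * ε ≤ 1 := by
    refine (mul_le_mul_of_nonneg_left ht1 hKR).trans ?_
    rw [mul_one_div, div_le_one (by positivity)]; linarith
  have hQ' : ∀ l : SiteL2K ℂ d (fineP L m) c₀ W,
      ‖(WL2.equiv ℂ (fun _ : TSite d (fineP L m) => c₀) W).symm (centreFun (weight L m) (centre L m)
        (QprimeW L m φ U l - QprimeW L m φ (fun _ : Bond d (fineP L m) => (1 : 𝔸ˣ)) l))‖ ≤ Cρ * (KR * ε) * ‖l‖ := fun l => by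
    rw [hCρdef]; exact norm_centreLift_QprimeW_sub_flat_le_linear L m φ U (c₀ := c₀) hεR0 hεR1 hR l
  -- (δ_Q) by NE9 leaf-04
  have hQ : ∀ y : BondL2K ℂ d (fineP L m) c₀ W, ‖QtorusW L m hL φ U hα1 hU1 hreg (c₁ := c₁) y -
      QtorusW L m hL φ (fun _ => 1) (show (0 : ℝ) ≤ 1 / 64 by norm_num) (hU1_one L m) (hreg_one L m) (c₁ := c₁) y‖ ≤ CQ * ε * ‖y‖ := fun y => by
    refine (norm_QtorusW_sub_flat_le_local L m hL U hα1 hU1 hreg (show (0 : ℝ) ≤ 1 / 64 by norm_num) (hU1_one L m) (hreg_one L m) hε hUε φ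
      hMφ hφ hMφ' hφ' y).trans (le_of_eq ?_)
    rw [hCQdef]; ring
  -- the budget `ε + ρ′ + δ_Q = (1 + CρKR + CQ)·ε ≤ ε₀`
  have ht_eq : ε + Cρ * (KR * ε) + CQ * ε = (1 + Cρ * KR + CQ) * ε := by ring
  have hbudget : ε + Cρ * (KR * ε) + CQ * ε ≤ ε₀ := by
    rw [ht_eq]
    have := mul_le_mul_of_nonneg_left ht2 (by positivity : (0 : ℝ) ≤ 1 + Cρ * KR + CQ)
    rwa [mul_div_cancel₀ _ (by positivity : (1 + Cρ * KR + CQ) ≠ 0)] at this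
  -- the principal part
  have hP := HP m U hα1 hU1 hreg hε (by positivity) (by positivity) hbudget hUb hUε hRS hQ' hQ x
  rw [ht_eq] at hP
  -- the curvature part
  have hpl : ∀ p : B9SectCLatticeCarrier.Plaq d (fineP L m), ‖(plaqHolU U p : 𝔸) - 1‖ ≤ 4 * ε := norm_plaqHolU_sub_one_le hUb hUε
  have hC : ‖curvOp φ τ η U x‖ ≤ Kc * ε * ‖x‖ := by
    refine (norm_curvOp_le φ hτ hCτ hφ η hUb' hpl hMφ (by positivity) x).trans (le_of_eq ?_)
    rw [hKcdef]; ring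
  -- the decomposition `Δ_a(U) − Δ_a(1) = (P(U) − P(1)) + Δ′(U)` (`Δ′(1) = 0`)
  have hU_eq : laplaceAofBackground L m hL φ U hα1 hU1 hreg τ η (c₀ := c₀) (c₁ := c₁) a x =
      laplaceALatticeK ((η : ℂ))⁻¹ (adTransportW φ U) (adTransportW φ fun b => (U b)⁻¹) (principalOpK φ η U) (RofU L m φ η U)
        (QtorusW L m hL φ U hα1 hU1 hreg (c₁ := c₁)) a x + curvOp φ τ η U x := by
    show laplaceALatticeK ((η : ℂ))⁻¹ (adTransportW φ U) (adTransportW φ fun b => (U b)⁻¹) (hessOp φ η U τ) (RofU L m φ η U)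
        (QtorusW L m hL φ U hα1 hU1 hreg (c₁ := c₁)) a x = _
    simp only [laplaceALatticeK, laplaceAK_apply, hessOp_apply]
    abel
  have h1_eq : laplaceAofBackground L m hL φ (fun _ => 1) (show (0 : ℝ) ≤ 1 / 64 by norm_num) (hU1_one L m) (hreg_one L m) τ η (c₀ := c₀) (c₁ := c₁) a x =
      laplaceALatticeK ((η : ℂ))⁻¹ (adTransportW φ (fun _ : Bond d (fineP L m) => (1 : 𝔸ˣ)))
        (adTransportW φ fun _ : Bond d (fineP L m) => (1 : 𝔸ˣ)⁻¹) (principalOpK φ η fun _ => 1) (RofU L m φ η fun _ => 1)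
        (QtorusW L m hL φ (fun _ => 1) (show (0 : ℝ) ≤ 1 / 64 by norm_num) (hU1_one L m) (hreg_one L m) (c₁ := c₁)) a x := by
    show laplaceALatticeK ((η : ℂ))⁻¹ (adTransportW φ (fun _ : Bond d (fineP L m) => (1 : 𝔸ˣ)))
        (adTransportW φ fun _ : Bond d (fineP L m) => (1 : 𝔸ˣ)⁻¹) (hessOp φ η (fun _ => 1) τ) (RofU L m φ η fun _ => 1)
        (QtorusW L m hL φ (fun _ => 1) (show (0 : ℝ) ≤ 1 / 64 by norm_num) (hU1_one L m) (hreg_one L m) (c₁ := c₁)) a x = _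
    rw [B9Eq310HessianOperator.hessOp_one]
  rw [hU_eq, h1_eq, add_sub_right_comm]
  calc _ ≤ ‖laplaceALatticeK ((η : ℂ))⁻¹ (adTransportW φ U) (adTransportW φ fun b => (U b)⁻¹) (principalOpK φ η U) (RofU L m φ η U)
            (QtorusW L m hL φ U hα1 hU1 hreg (c₁ := c₁)) a x -
          laplaceALatticeK ((η : ℂ))⁻¹ (adTransportW φ (fun _ : Bond d (fineP L m) => (1 : 𝔸ˣ)))
            (adTransportW φ fun _ : Bond d (fineP L m) => (1 : 𝔸ˣ)⁻¹) (principalOpK φ η fun _ => 1) (RofU L m φ η fun _ => 1)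
            (QtorusW L m hL φ (fun _ => 1) (show (0 : ℝ) ≤ 1 / 64 by norm_num) (hU1_one L m) (hreg_one L m) (c₁ := c₁)) a x‖ +
        ‖curvOp φ τ η U x‖ := norm_add_le _ _
    _ ≤ K * ((1 + Cρ * KR + CQ) * ε) * ‖x‖ + Kc * ε * ‖x‖ := add_le_add hP hC
    _ ≤ (K * (1 + Cρ * KR + CQ) + Kc + 1) * ε * ‖x‖ := by nlinarith [norm_nonneg x]

end Assembled

end Literature.MathematicalPhysics.QuantumFieldTheory.Balaban1983to89.B9Eq384LaplaceALipschitzUniform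

end
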